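import Summits.ValiantsHypothesis.ValiantsHypothesis.Theorems.BarrierLeverPartitionMinorsHitByVPMooreBall

/-!
# Route BarrierLever — item `PartitionMinorsHitByVP` (stmt-ValiantsHypothesis-19717):
# the canonical BALL × BALL Moore matrix and the Pascal split of a Hamming ball (definitions)

Helper file (`--supports stmt-ValiantsHypothesis-19717`; cell valiant-natproofs, rung V4, 𝒟-side door (c); prover
seat val-np-p6 gen 6). Closes NO item. DEFINITIONS ONLY (plus their bookkeeping lemmas); the mathematics — the
LOW-ORDER PEEL of the Moore–ball determinant and the unconditional class «ball rows × ball columns, every radius» —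
is in the companion `…HitByVPMooreBallBall` (definition-free), which imports this file.

* `Ball n e` — the Hamming ball `B([n], e)` as a finite index TYPE (`{S : Finset (Fin n) // S.card ≤ e}`), so that
  the ball × ball matrices below are honestly square (`Matrix (Ball n e) (Ball n e)`), with no enumeration data.
* `ballEta p n S = X (Fin.last n) + Σ_{a ∈ S} X (Fin.castSucc a)` — the node form of `S ⊆ [n]` in
  `𝔽_p[Y_0, …, Y_{n-1}; Y_n]`; the CONSTANT variable is put LAST so that `MvPolynomial.finSuccEquiv` peels node `0`.
* `ballWt p n d W = Σ_{c ∈ W} p ^ (d c)` — the weight of a digit set for a digit-exponent map `d : Fin n → ℕ`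
  (the item's exponents are `d = id`; the recursion needs `d ∘ Fin.succ`, which is why `d` is a parameter).
* `bbMatrix p n e d = [ballEta S ^ ballWt d W]_{S, W ∈ Ball n e}` — the canonical ball × ball Moore matrix
  (`= [η_S^{Σ_{c∈W} p^c}]` of `…FrobeniusDoorCharP` / `MooreBallNonsingularChar` restricted to ball columns, for `d = id`).
* `dropZero`, `ballSplit n e : Ball (n+1) (e+1) ≃ Ball n (e+1) ⊕ Ball n e` (members avoiding node `0` ↦ shift down;
  members containing `0` ↦ remove it and shift down — the Pascal recursion `|B(n+1,e+1)| = |B(n,e+1)| + |B(n,e)|` as an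
  equivalence), `ballIncl : Ball n e → Ball n (e+1)`.

WHAT THIS IS NOT: no theorem about item 19717 here (see the companion); nothing on crux 14610 or VP vs VNP.
-/

set_option linter.dupNamespace false

namespace Summit.ValiantsHypothesis.ValiantsHypothesis.Theorems.BarrierLever.FrobeniusDoor

open Finset MvPolynomial Matrix

noncomputable section

/-! ## 1. Balls as index types, the node forms and the canonical ball × ball Moore matrix -/

/-- The Hamming ball `B([n], e)` as a finite type: the subsets of `Fin n` of size `≤ e`. -/
abbrev Ball (n e : ℕ) : Type := {S : Finset (Fin n) // S.card ≤ e}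

variable (p : ℕ)

/-- The node form of `S ⊆ [n]` in `𝔽_p[Y_0, …, Y_{n-1}, Y_n]` with the CONSTANT variable put LAST:
`η S = X (Fin.last n) + Σ_{a ∈ S} X (Fin.castSucc a)`. -/
def ballEta (n : ℕ) (S : Finset (Fin n)) : MvPolynomial (Fin (n + 1)) (ZMod p) :=
  X (Fin.last n) + ∑ a ∈ S, X (Fin.castSucc a)

/-- The weight `Σ_{c ∈ W} p^{d c}` of a digit set `W` for a digit-exponent map `d`. -/
def ballWt (n : ℕ) (d : Fin n → ℕ) (W : Finset (Fin n)) : ℕ := ∑ c ∈ W, p ^ d c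

/-- The canonical **ball × ball Moore matrix** `[η_S ^ (Σ_{c∈W} p^{d c})]_{S, W ∈ B([n], e)}`. -/
def bbMatrix (n e : ℕ) (d : Fin n → ℕ) :
    Matrix (Ball n e) (Ball n e) (MvPolynomial (Fin (n + 1)) (ZMod p)) :=
  Matrix.of fun S W => ballEta p n S.1 ^ ballWt p n d W.1

/-! ## 2. Splitting the ball at node `0` -/

/-- Drop node `0` and shift the other nodes down: `S ↦ {a : a.succ ∈ S}`. -/
def dropZero {n : ℕ} (S : Finset (Fin (n + 1))) : Finset (Fin n) :=
  S.preimage Fin.succ (Fin.succ_injective n).injOn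

/-- If `0 ∉ S`, shifting `dropZero S` back up recovers `S`. -/
theorem map_succEmb_dropZero_of_not_mem {n : ℕ} (S : Finset (Fin (n + 1))) (h0 : (0 : Fin (n + 1)) ∉ S) :
    (dropZero S).map (Fin.succEmb n) = S := by
  ext x
  simp only [dropZero, Finset.mem_map, Finset.mem_preimage, Fin.coe_succEmb]
  constructor
  · rintro ⟨a, ha, rfl⟩; exact ha
  · intro hx
    rcases Fin.eq_zero_or_eq_succ x with rfl | ⟨a, rfl⟩
    · exact absurd hx h0
    · exact ⟨a, hx, rfl⟩

/-- Shifting `dropZero S` back up gives `S` without `0`. -/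
theorem map_succEmb_dropZero_of_mem {n : ℕ} (S : Finset (Fin (n + 1))) :
    (dropZero S).map (Fin.succEmb n) = S.erase 0 := by
  ext x
  simp only [dropZero, Finset.mem_map, Finset.mem_preimage, Fin.coe_succEmb, Finset.mem_erase]
  constructor
  · rintro ⟨a, ha, rfl⟩; exact ⟨Fin.succ_ne_zero a, ha⟩
  · rintro ⟨hx0, hx⟩
    rcases Fin.eq_zero_or_eq_succ x with rfl | ⟨a, rfl⟩
    · exact absurd rfl hx0
    · exact ⟨a, hx, rfl⟩

/-- `dropZero` is a left inverse of the shift `map succEmb`. -/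
theorem dropZero_map_succEmb {n : ℕ} (S : Finset (Fin n)) : dropZero (S.map (Fin.succEmb n)) = S := by
  ext a
  simp [dropZero]

/-- `dropZero` of `insert 0 (shift S)` is `S`. -/
theorem dropZero_insert_zero_map_succEmb {n : ℕ} (S : Finset (Fin n)) :
    dropZero (insert 0 (S.map (Fin.succEmb n))) = S := by
  ext a
  simp [dropZero, Fin.succ_ne_zero]

/-- Cardinality of `dropZero S` when `0 ∉ S`. -/
theorem card_dropZero_of_not_mem {n : ℕ} (S : Finset (Fin (n + 1))) (h0 : (0 : Fin (n + 1)) ∉ S) :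
    (dropZero S).card = S.card := by
  conv_rhs => rw [← map_succEmb_dropZero_of_not_mem S h0]
  rw [Finset.card_map]

/-- Cardinality of `dropZero S` when `0 ∈ S`. -/
theorem card_dropZero_of_mem {n : ℕ} (S : Finset (Fin (n + 1))) (h0 : (0 : Fin (n + 1)) ∈ S) :
    (dropZero S).card + 1 = S.card := by
  have := Finset.card_map (Fin.succEmb n) (s := dropZero S)
  rw [map_succEmb_dropZero_of_mem] at this
  rw [← this, Finset.card_erase_add_one h0]

/-- Rows/columns of `B([n+1], e+1)` avoiding node `0` ↔ `B([n], e+1)`; containing `0` ↔ `B([n], e)`. -/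
def ballSplit (n e : ℕ) : Ball (n + 1) (e + 1) ≃ Ball n (e + 1) ⊕ Ball n e where
  toFun S := if h0 : (0 : Fin (n + 1)) ∈ S.1 then
      Sum.inr ⟨dropZero S.1, by have := card_dropZero_of_mem S.1 h0; have := S.2; omega⟩
    else Sum.inl ⟨dropZero S.1, by rw [card_dropZero_of_not_mem S.1 h0]; exact S.2⟩
  invFun := Sum.elim (fun S' => ⟨S'.1.map (Fin.succEmb n), by rw [Finset.card_map]; exact S'.2⟩)
    (fun S' => ⟨insert 0 (S'.1.map (Fin.succEmb n)), by
      rw [Finset.card_insert_of_notMem (by simp [Fin.succ_ne_zero])]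
      have := S'.2; rw [Finset.card_map]; omega⟩)
  left_inv S := by
    by_cases h0 : (0 : Fin (n + 1)) ∈ S.1
    · simp only [h0, ↓reduceDIte, Sum.elim_inr]
      apply Subtype.ext
      simp only
      rw [map_succEmb_dropZero_of_mem, Finset.insert_erase h0]
    · simp only [h0, ↓reduceDIte, Sum.elim_inl]
      apply Subtype.ext
      simp only
      rw [map_succEmb_dropZero_of_not_mem _ h0]
  right_inv := by
    rintro (S' | S')
    · have h0 : (0 : Fin (n + 1)) ∉ S'.1.map (Fin.succEmb n) := by simp [Fin.succ_ne_zero]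
      simp only [Sum.elim_inl, h0, ↓reduceDIte, dropZero_map_succEmb]
    · have h0 : (0 : Fin (n + 1)) ∈ insert 0 (S'.1.map (Fin.succEmb n)) := Finset.mem_insert_self _ _
      simp only [Sum.elim_inr, h0, ↓reduceDIte, dropZero_insert_zero_map_succEmb]

/-- The inverse split on the «avoids `0`» summand is the shift. -/
theorem ballSplit_symm_inl (n e : ℕ) (S' : Ball n (e + 1)) :
    ((ballSplit n e).symm (Sum.inl S')).1 = S'.1.map (Fin.succEmb n) := rfl

/-- The inverse split on the «contains `0`» summand is `insert 0 ∘ shift`. -/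
theorem ballSplit_symm_inr (n e : ℕ) (S' : Ball n e) :
    ((ballSplit n e).symm (Sum.inr S')).1 = insert 0 (S'.1.map (Fin.succEmb n)) := rfl


/-- The inclusion `B([n], e) ↪ B([n], e+1)`. -/
def ballIncl (n e : ℕ) (S : Ball n e) : Ball n (e + 1) := ⟨S.1, Nat.le_succ_of_le S.2⟩

end

end Summit.ValiantsHypothesis.ValiantsHypothesis.Theorems.BarrierLever.FrobeniusDoor
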